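import Mathlib
import Summits.ValiantsHypothesis.ValiantsHypothesis.Theorems.FifoMatchingNNNotVPSupportFnMonotoneBasis
import Summits.ValiantsHypothesis.ValiantsHypothesis.Theorems.FifoMatchingNNLowDegreeCofactorHardCarveMatchings
import HarnessLib

/-!
# Route FifoMatching — crux `NNNotVP` (stmt-ValiantsHypothesis-11615), line `division_split`:
# stub A from a lower bound on `circuitSizeOver monotoneBasis`

Registered line `Cruxes/NNNotVP/Lines/division_split.lean`; objects `σ` / `NN` / `SuppFn` /
`freeVars` = the line's vocabulary (`Theorems/FifoMatchingNNNotVPDivisionSplitDefs.lean`).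

* `suppFn_NN_univ_and_empty` — the support function of `NN_n` (`n ≥ 1`) is not constant;
* `core_of_circuitSizeOver_lowerBound` — a super-quasi-polynomial lower bound on
  `circuitSizeOver monotoneBasis` (the tree's canonical monotone Boolean complexity) of nest-free
  perfect-matching EXISTENCE on the ordered arc sets of `[2n]` (= shuffle-square recognition)
  implies the core of stub A (via the constants-free Boolean shadow
  `exists_monotoneCircuit_eval_ne_zero_pure`: at most `L₊ + 8n²` gates, and
  `2^((log₂ n + c)^c) + 8n² ≤ 2^((log₂ n + c + 3)^(c+3))`);
* `supportFnHard_of_circuitSizeOver_lowerBound` — hence stub A (`stub_supportFnHard`) verbatim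
  (`supportFnHard_of_core`).

Honest framing: a reduction; that monotone Boolean lower bound is OPEN (no monotone lower bound for
shuffle-square recognition is in print), so are stubs Z / A / B2, the crux `NNNotVP` and
`VP ≠ VNP` (NOT proved).  No definitions, no named facts.
-/

noncomputable section

-- Sub = Summit single-conjunct layout: the duplicated namespace component is mandated by the tree.
set_option linter.dupNamespace false

namespace Summit.ValiantsHypothesis.ValiantsHypothesis.Theorems.FifoMatching.NNNotVP.DivisionSplit

open MvPolynomial Literature.Computability.AlgebraicComplexity
open Literature.Computability.Complexity
open Literature.Computability.Complexity.GateList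
open scoped NNReal BigOperators Classical

variable {τ : Type*}

/-! ### The core of stub A from a lower bound on `circuitSizeOver monotoneBasis` -/

/-- `NN_n` does not vanish at `(1,…,1)` (the consecutive-pairs matching is nest-free) and, for
`n ≥ 1`, vanishes at `(0,…,0)` (every monomial has `n ≥ 1` arcs). [folklore] -/
theorem suppFn_NN_univ_and_empty (n : ℕ) (hn : 1 ≤ n) :
    SuppFn (NN n) Finset.univ ∧ ¬ SuppFn (NN n) ∅ := by
  have hsupp : (NN n).support = (nestFreeMatchings (2 * n)).image arcExponent :=
    support_nestFreeMatchingPoly n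
  constructor
  · refine ⟨arcExponent (fun i : Fin (2 * n) => NNLowDegreeCofactorHard.FreedVertices.Carve.partner i),
      ?_, Finset.subset_univ _⟩
    rw [hsupp]
    exact Finset.mem_image_of_mem _
      (NNLowDegreeCofactorHard.FreedVertices.Carve.partner_mem_nestFreeMatchings n)
  · rintro ⟨m, hm, hm0⟩
    rw [hsupp] at hm
    obtain ⟨M, hM, rfl⟩ := Finset.mem_image.1 hm
    have hcard := card_openers (nestFreeMatchings_subset_perfectMatchings hM)
    have hne : (openers M).Nonempty := Finset.card_pos.1 (by omega)
    obtain ⟨i, hi⟩ := hne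
    have hmem : (i, M i) ∈ (arcExponent M).support := by
      rw [arcExponent, Finsupp.mem_support_iff, Finsupp.finsetSum_apply]
      rw [Finset.sum_eq_single i]
      · simp
      · intro j _ hji
        rw [Finsupp.single_apply, if_neg]
        intro h
        exact hji (Prod.ext_iff.1 h).1
      · intro h; exact absurd hi h
    exact Finset.notMem_empty _ (hm0 hmem)

/-- **A lower bound on `circuitSizeOver monotoneBasis` implies the core of stub A.**  If, for
every `c`, eventually every `{∧₂, ∨₂}`-circuit computing nest-free perfect-matching EXISTENCE on the
ordered arc sets of `[2n]` (the support function of `NN_n`; shuffle-square recognition) has more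
than `2^((log₂ n + c)^c)` gates, then every nonnegative polynomial with the support function of
`NN_n` has `L₊ > 2^((log₂ n + c)^c)` eventually (its Boolean shadow over `monotoneBasis` has at
most `L₊ + 8n²` gates, and `8n² + 2^((log₂ n + c)^c) ≤ 2^((log₂ n + c + 3)^(c+3))`). [folklore] -/
theorem core_of_circuitSizeOver_lowerBound
    (hB : ∀ c : ℕ, ∃ n₀ : ℕ, ∀ n ≥ n₀, 2 ^ ((Nat.log 2 n + c) ^ c) <
      circuitSizeOver monotoneBasis
        (fun x : σ n → Bool => decide (SuppFn (NN n) (Finset.univ.filter fun e => x e = true)))) :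
    ∀ c : ℕ, ∃ n₀ : ℕ, ∀ n ≥ n₀, ∀ g : MvPolynomial (σ n) ℝ≥0,
      (∀ A : Finset (σ n), SuppFn g A ↔ SuppFn (NN n) A) →
        2 ^ ((Nat.log 2 n + c) ^ c) < complexity g := by
  intro c
  obtain ⟨n₀, hn₀⟩ := hB (c + 3)
  refine ⟨max n₀ 1, fun n hn g hg => ?_⟩
  have hn0 : n₀ ≤ n := le_trans (le_max_left _ _) hn
  have hn1 : 1 ≤ n := le_trans (le_max_right _ _) hn
  obtain ⟨hU, hE⟩ := suppFn_NN_univ_and_empty n hn1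
  -- the support function of `g` is not constant
  have h1 : eval (fun _ => (1 : ℝ≥0)) g ≠ 0 := by
    have h := (suppFn_iff_eval_ne_zero g Finset.univ).1 ((hg _).2 hU)
    simpa using h
  have h0 : eval (fun _ => (0 : ℝ≥0)) g = 0 := by
    by_contra h
    apply hE
    rw [← hg]
    rw [suppFn_iff_eval_ne_zero]
    simpa using h
  obtain ⟨C, hC1, hC2, hC3⟩ := exists_monotoneCircuit_eval_ne_zero_pure g h1 h0
  have hcomp : C.Computes
      (fun x : σ n → Bool => decide (SuppFn (NN n) (Finset.univ.filter fun e => x e = true))) := by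
    intro x
    rw [hC3 x]
    apply decide_eq_decide.2
    rw [← hg, suppFn_iff_eval_ne_zero]
    simp [Finset.mem_filter]
  have hsize := circuitSizeOver_le_of_computes C hC1 hcomp
  have hlt := lt_of_lt_of_le (hn₀ n hn0) (hsize.trans hC2)
  -- `|σ n| = 4n²` and `8n² + 2^((L+c)^c) ≤ 2^((L+c+3)^(c+3))` with `L = ⌊log₂ n⌋`
  have hcard : Fintype.card (σ n) = 2 * n * (2 * n) := by
    simp [σ, Fintype.card_prod, Fintype.card_fin]
  rw [hcard] at hlt
  have hnL : n < 2 ^ (Nat.log 2 n + 1) := Nat.lt_pow_succ_log_self (by norm_num) n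
  have h8 : 2 * (2 * n * (2 * n)) < 2 ^ (2 * Nat.log 2 n + 5) := by
    have h' : n * n < 2 ^ (Nat.log 2 n + 1) * 2 ^ (Nat.log 2 n + 1) :=
      Nat.mul_lt_mul_of_lt_of_le' hnL hnL.le (by omega)
    have hp : 2 ^ (2 * Nat.log 2 n + 5) = 8 * (2 ^ (Nat.log 2 n + 1) * 2 ^ (Nat.log 2 n + 1)) := by
      rw [show 2 * Nat.log 2 n + 5 = 3 + ((Nat.log 2 n + 1) + (Nat.log 2 n + 1)) by omega,
        pow_add, pow_add]
      norm_num
    rw [hp]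
    calc 2 * (2 * n * (2 * n)) = 8 * (n * n) := by ring
      _ < 8 * (2 ^ (Nat.log 2 n + 1) * 2 ^ (Nat.log 2 n + 1)) :=
          (Nat.mul_lt_mul_left (by norm_num : 0 < 8)).2 h'
  have hA : (Nat.log 2 n + c) ^ c + 1 ≤ (Nat.log 2 n + (c + 3)) ^ (c + 3) := by
    have h1' : 1 ≤ (Nat.log 2 n + c) ^ c := by
      rcases Nat.eq_zero_or_pos c with hc | hc
      · subst hc; simp
      · exact Nat.one_le_pow _ _ (by omega)
    calc (Nat.log 2 n + c) ^ c + 1 ≤ (Nat.log 2 n + c) ^ c * 27 := by omega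
      _ ≤ (Nat.log 2 n + (c + 3)) ^ c * (Nat.log 2 n + (c + 3)) ^ 3 :=
          Nat.mul_le_mul (Nat.pow_le_pow_left (by omega) c)
            (by calc 27 = 3 ^ 3 := by norm_num
                  _ ≤ (Nat.log 2 n + (c + 3)) ^ 3 := Nat.pow_le_pow_left (by omega) 3)
      _ = (Nat.log 2 n + (c + 3)) ^ (c + 3) := by rw [← pow_add]
  have hB' : 2 * Nat.log 2 n + 5 + 1 ≤ (Nat.log 2 n + (c + 3)) ^ (c + 3) := by
    have hM1 : 2 * Nat.log 2 n + 5 + 1 ≤ 2 * (Nat.log 2 n + (c + 3)) := by omega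
    have hM2 : 2 * (Nat.log 2 n + (c + 3)) ≤ (Nat.log 2 n + (c + 3)) * (Nat.log 2 n + (c + 3)) :=
      Nat.mul_le_mul_right _ (by omega)
    have hM3 : (Nat.log 2 n + (c + 3)) * (Nat.log 2 n + (c + 3)) ≤
        (Nat.log 2 n + (c + 3)) * (Nat.log 2 n + (c + 3)) * (Nat.log 2 n + (c + 3)) :=
      Nat.le_mul_of_pos_right _ (by omega)
    calc 2 * Nat.log 2 n + 5 + 1
        ≤ (Nat.log 2 n + (c + 3)) * (Nat.log 2 n + (c + 3)) * (Nat.log 2 n + (c + 3)) :=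
          hM1.trans (hM2.trans hM3)
      _ = (Nat.log 2 n + (c + 3)) ^ 3 := by ring
      _ ≤ (Nat.log 2 n + (c + 3)) ^ (c + 3) := Nat.pow_le_pow_right (by omega) (by omega)
  have hsum : 2 ^ ((Nat.log 2 n + c) ^ c) + 2 ^ (2 * Nat.log 2 n + 5) ≤
      2 ^ ((Nat.log 2 n + (c + 3)) ^ (c + 3)) := by
    have e1 : 2 ^ ((Nat.log 2 n + c) ^ c) ≤ 2 ^ ((Nat.log 2 n + (c + 3)) ^ (c + 3) - 1) :=
      Nat.pow_le_pow_right (by norm_num) (by omega)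
    have e2 : 2 ^ (2 * Nat.log 2 n + 5) ≤ 2 ^ ((Nat.log 2 n + (c + 3)) ^ (c + 3) - 1) :=
      Nat.pow_le_pow_right (by norm_num) (by omega)
    have e3 : 2 ^ ((Nat.log 2 n + (c + 3)) ^ (c + 3) - 1) * 2 =
        2 ^ ((Nat.log 2 n + (c + 3)) ^ (c + 3)) := by
      rw [← pow_succ]
      congr 1
      omega
    omega
  omega

/-- **A lower bound on `circuitSizeOver monotoneBasis` implies stub A (`stub_supportFnHard`)
verbatim** (`core_of_circuitSizeOver_lowerBound` ∘ `supportFnHard_of_core`). [folklore] -/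
theorem supportFnHard_of_circuitSizeOver_lowerBound
    (hB : ∀ c : ℕ, ∃ n₀ : ℕ, ∀ n ≥ n₀, 2 ^ ((Nat.log 2 n + c) ^ c) <
      circuitSizeOver monotoneBasis
        (fun x : σ n → Bool => decide (SuppFn (NN n) (Finset.univ.filter fun e => x e = true)))) :
    ∀ k c : ℕ, ∃ n₀ : ℕ, ∀ n ≥ n₀, ∀ T : Finset (σ n), T.card ≤ (Nat.log 2 n + k) ^ k →
      ∀ g : MvPolynomial (σ n) ℝ≥0, (∀ A : Finset (σ n), SuppFn g A ↔ SuppFn (freeVars T (NN n)) A) →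
        2 ^ ((Nat.log 2 n + c) ^ c) < complexity g :=
  supportFnHard_of_core (core_of_circuitSizeOver_lowerBound hB)

end Summit.ValiantsHypothesis.ValiantsHypothesis.Theorems.FifoMatching.NNNotVP.DivisionSplit

end
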